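import Summits.Parity.GeneralizedHardyLittlewood.Theorems.PrimeLevelFamEdgeMomentsBeyondDiagonalDiagDecorCross
import Summits.Parity.GeneralizedHardyLittlewood.Theorems.PrimeLevelFamEdgeMomentsBeyondDiagonalDiagDecorPrimePowPeelMixed
import HarnessLib

/-!
# Route `PrimeLevelFamEdge`, crux K_A `MomentsBeyondDiagonal` (stmt-Parity-20007), line «petersson_layers» v4, stub `stub_diag`:
# **the `P₂P₄`-decorated coprime Selberg sum: `Σ_{k≤y,(k,n)=1}τ(k)W(k)P₂(k)P₄(k)logᶜ(y/k) = −216·(c!/(c+4)!)·E_n·log^{c+4}y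
# + O(D(n)(1+κ(n))(1+log y)^{c+3})`** (`c ≥ 2`) — the mixed family of `M₆ = τ(15P₂³ − 30P₂P₄ + 16P₆)`

By the mixed double peel `…DiagDecorPrimePowPeelMixed.sum_copTauW_mul_primePow_mul_primePow_eq` (`m = 2`, `m′ = 4`) the sum is
the `P₆`-peel (`…DiagDecorPrimePowTwo.abs_coprimeSumPow_primePow_add_le_of_two_le 5`: `−240·c!/(c+4)!`) plus the cross term
with inner decoration `P₄` (`…DiagDecorCross.abs_decorCross_sub_le` over `…DecorPrimePowTwo … 3`: `+24·c!/(c+4)!`):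

* `p2p4_factorial_identity` — the coefficient bookkeeping (`240 − 24 = 216` in units `c!/(c+4)!`);
* `abs_coprimeSumPow_primeSq_primeFourth_add_le` — **the displayed asymptotic**.

(With `P₆ ↦ −240`, `P₂P₄ ↦ −216` and `P₂³ ↦ −176` — the latter = `P₆`-peel `+ 2·`cross(`log⁴p`, inner `P₂`) `+` cross(`log²p`,
inner `P₂²` of `…DiagDecorPrimeSqSq`), next brick — one gets `15(−176) − 30(−216) + 16(−240) = 0`: the `M₆`-decorated coprime
sums have no `log^{c+4}` term, exactly as `…DiagDecorM4Coprime` for `M₄`.) Def-free; theorems only. Helper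
`--supports stmt-Parity-20007`; closes nothing; K_A, K_B and the Parity summit are NOT proved; nothing about Landau–Siegel zeros.

## References
* E. Kowalski, P. Michel, J. VanderKam, J. reine angew. Math. 526 (2000), (23)–(28) pp. 13–15 and Prop. 5.1 p. 18.
  [cite: KowalskiMichelVanderKam2000, (23)–(28) — derivation (prime-power-log decorations of the Selberg coordinates)]
-/

noncomputable section

open scoped Real
open Finset ArithmeticFunction

namespace Summit.Parity.GeneralizedHardyLittlewood.Theorems.MomentsBeyondDiagonal.DiagKernel

open Literature.NumberTheory.LFunctions Literature.NumberTheory.LFunctions.KMV2000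
open SelbergCoord (kappa)
open Summit.Parity.GeneralizedHardyLittlewood.Theorems.BeyondDiagonalBeatsQuarter.KernelFormXSq
  (copTauW mainConst divWeight divWeight_nonneg mainConst_nonneg)
open Summit.Parity.GeneralizedHardyLittlewood.Theorems.MomentsBeyondDiagonal.DiagLines
  (sum_copTauW_mul_mul_sum_primeFactors_eq sum_copTauW_mul_primePow_mul_primePow_eq)

/-- The coefficient bookkeeping of the `P₂P₄` family: for `c ≥ 2`,
`2c(c−1)·(5!(c−2)!/(c+4)!) − 2·(2c(c−1)·(3!(c−2)!/(c+2)!))·(1!(c+2)!/(c+4)!) = 216·c!/(c+4)!`. [folklore] -/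
theorem p2p4_factorial_identity {c : ℕ} (hc : 2 ≤ c) :
    2 * ((c : ℝ) * ((c : ℝ) - 1)) * (((Nat.factorial 5 : ℕ) : ℝ) * (c - 2).factorial / (c + 4).factorial) -
        2 * (2 * ((c : ℝ) * ((c : ℝ) - 1)) * (((Nat.factorial 3 : ℕ) : ℝ) * (c - 2).factorial / (c + 2).factorial)) *
          (((Nat.factorial 1 : ℕ) : ℝ) * (c + 2).factorial / (c + 4).factorial) =
      216 * ((c.factorial : ℝ) / (c + 4).factorial) := by
  obtain ⟨j, rfl⟩ : ∃ j, c = j + 2 := ⟨c - 2, by omega⟩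
  have e1 : j + 2 - 2 = j := by omega
  rw [e1]
  have h2 : ((j + 2).factorial : ℝ) = ((j : ℝ) + 2) * ((j : ℝ) + 1) * j.factorial := by
    have : (j + 2).factorial = (j + 2) * ((j + 1) * j.factorial) := by
      rw [show j + 2 = (j + 1) + 1 by omega, Nat.factorial_succ, Nat.factorial_succ]
    rw [this]; push_cast; ring
  have hF2 : ((j + 2 + 2).factorial : ℝ) ≠ 0 := by exact_mod_cast Nat.factorial_ne_zero _
  have hF4 : ((j + 2 + 4).factorial : ℝ) ≠ 0 := by exact_mod_cast Nat.factorial_ne_zero _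
  rw [h2, show Nat.factorial 5 = 120 from rfl, show Nat.factorial 3 = 6 from rfl, show Nat.factorial 1 = 1 from rfl]
  push_cast
  field_simp
  ring

/-- **The `P₂P₄`-decorated coprime Selberg sum** (`c ≥ 2`): there is `C` with, for all `n ≥ 1`, `y ≥ 1`,
`|Σ_{k≤y} a_n(k)·logᶜ(y/k)·P₂(k)P₄(k) + 216·(c!/(c+4)!)·E_n·log^{c+4}y| ≤ C·D(n)(1+κ(n))(1+log y)^{c+3}`.
[cite: KowalskiMichelVanderKam2000, (23)–(28) — derivation] -/
theorem abs_coprimeSumPow_primeSq_primeFourth_add_le {c : ℕ} (hc : 2 ≤ c) :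
    ∃ C : ℝ, 0 < C ∧ ∀ n : ℕ, n ≠ 0 → ∀ y : ℝ, 1 ≤ y →
      |∑ k ∈ Icc 1 ⌊y⌋₊, copTauW n k * Real.log (y / k) ^ c *
          ((∑ p ∈ k.primeFactors, Real.log p ^ 2) * ∑ p ∈ k.primeFactors, Real.log p ^ 4) +
          216 * ((c.factorial : ℝ) / (c + 4).factorial) * mainConst n * Real.log y ^ (c + 4)| ≤
        C * divWeight n * (1 + kappa n) * (1 + Real.log y) ^ (c + 3) := by
  obtain ⟨C₆, hC₆, h₆⟩ := abs_coprimeSumPow_primePow_add_le_of_two_le 5 hc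
  obtain ⟨C₄, hC₄, h₄⟩ := abs_coprimeSumPow_primePow_add_le_of_two_le 3 hc
  obtain ⟨C_X, hC_X, hX⟩ := abs_decorCross_sub_le (fun k : ℕ ↦ ∑ p ∈ k.primeFactors, Real.log p ^ (3 + 1)) 1 (c - 2 + 3)
    hC₄ h₄
  refine ⟨C₆ + C_X, by positivity, fun n hn y hy ↦ ?_⟩
  set N := ⌊y⌋₊ with hN
  have hP6 := h₆ n hn y hy
  have hXn := hX n hn y hy
  beta_reduce at hXn
  have e56 : c - 2 + 5 = c + 3 := by omega
  have e34 : c - 2 + 3 + 1 + 1 = c + 3 := by omega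
  rw [show ((5 : ℕ) + 1) = 6 from rfl, e56] at hP6
  rw [show ((3 : ℕ) + 1) = 4 from rfl, show ((1 : ℕ) + 1) = 2 from rfl, e34] at hXn
  -- decomposition `Σ aG·P₂P₄ = P₆-peel + cross`
  have hpeel6 := sum_copTauW_mul_mul_sum_primeFactors_eq n N (fun k : ℕ ↦ Real.log (y / k) ^ c)
    (fun p : ℕ ↦ Real.log p ^ 6)
  have hmix := sum_copTauW_mul_primePow_mul_primePow_eq n N 2 4 (fun k : ℕ ↦ Real.log (y / k) ^ c)
  beta_reduce at hpeel6 hmix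
  rw [show 2 + 4 = 6 from rfl, ← hpeel6] at hmix
  rw [hmix]
  -- main terms
  have hid := p2p4_factorial_identity hc
  have e6 : c + 3 + 1 = c + 4 := by omega
  have e4 : c - 2 + 3 + 1 = c + 2 := by omega
  rw [e6] at hP6
  rw [e4, e6] at hXn
  have key : ∀ {A X M₁ M₂ M : ℝ}, M₁ - M₂ = M → A + X + M = (A + M₁) + (X - M₂) := by
    intro A X M₁ M₂ M h; rw [← h]; ring
  rw [key (M₁ := 2 * ((c : ℝ) * ((c : ℝ) - 1)) * (((Nat.factorial 5 : ℕ) : ℝ) * (c - 2).factorial / (c + 4).factorial) *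
      mainConst n * Real.log y ^ (c + 4))
    (M₂ := 2 * (2 * ((c : ℝ) * ((c : ℝ) - 1)) * (((Nat.factorial 3 : ℕ) : ℝ) * (c - 2).factorial / (c + 2).factorial)) *
      (((Nat.factorial 1 : ℕ) : ℝ) * (c + 2).factorial / (c + 4).factorial) * mainConst n * Real.log y ^ (c + 4))
    (by rw [show 2 * ((c : ℝ) * ((c : ℝ) - 1)) * (((Nat.factorial 5 : ℕ) : ℝ) * (c - 2).factorial / (c + 4).factorial) *
        mainConst n * Real.log y ^ (c + 4) -
        2 * (2 * ((c : ℝ) * ((c : ℝ) - 1)) * (((Nat.factorial 3 : ℕ) : ℝ) * (c - 2).factorial / (c + 2).factorial)) *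
          (((Nat.factorial 1 : ℕ) : ℝ) * (c + 2).factorial / (c + 4).factorial) * mainConst n * Real.log y ^ (c + 4) =
        (2 * ((c : ℝ) * ((c : ℝ) - 1)) * (((Nat.factorial 5 : ℕ) : ℝ) * (c - 2).factorial / (c + 4).factorial) -
          2 * (2 * ((c : ℝ) * ((c : ℝ) - 1)) * (((Nat.factorial 3 : ℕ) : ℝ) * (c - 2).factorial / (c + 2).factorial)) *
            (((Nat.factorial 1 : ℕ) : ℝ) * (c + 2).factorial / (c + 4).factorial)) *
          (mainConst n * Real.log y ^ (c + 4)) by ring, hid]; ring)]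
  calc _ ≤ |∑ k ∈ Icc 1 N, copTauW n k * Real.log (y / k) ^ c * ∑ p ∈ k.primeFactors, Real.log p ^ 6 +
          2 * ((c : ℝ) * ((c : ℝ) - 1)) * (((Nat.factorial 5 : ℕ) : ℝ) * (c - 2).factorial / (c + 4).factorial) *
            mainConst n * Real.log y ^ (c + 4)| +
        |∑ p ∈ (Icc 1 N).filter Nat.Prime, Real.log p ^ 2 * copTauW n p *
          ∑ k ∈ Icc 1 (N / p), copTauW (n * p) k *
            (Real.log (y / ((p * k : ℕ) : ℝ)) ^ c * ∑ q ∈ k.primeFactors, Real.log q ^ 4) -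
          2 * (2 * ((c : ℝ) * ((c : ℝ) - 1)) * (((Nat.factorial 3 : ℕ) : ℝ) * (c - 2).factorial / (c + 2).factorial)) *
            (((Nat.factorial 1 : ℕ) : ℝ) * (c + 2).factorial / (c + 4).factorial) * mainConst n * Real.log y ^ (c + 4)| :=
        abs_add_le _ _
    _ ≤ C₆ * divWeight n * (1 + kappa n) * (1 + Real.log y) ^ (c + 3) +
        C_X * divWeight n * (1 + kappa n) * (1 + Real.log y) ^ (c + 3) := add_le_add hP6 hXn
    _ = (C₆ + C_X) * divWeight n * (1 + kappa n) * (1 + Real.log y) ^ (c + 3) := by ring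

end Summit.Parity.GeneralizedHardyLittlewood.Theorems.MomentsBeyondDiagonal.DiagKernel

end
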